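import Summits.QuantumFields.YangMills.Theorems.EntropyBudgetEquipartitionFreeEnergyRateUnitaryRate
import Literature.MathematicalPhysics.QuantumLattice.RepLieAlgebraUnitary

/-!
# The body of crux `FreeEnergyRate` holds for the unitary model `(G, r) = (U(N), defining representation)`

Helper for the crux `FreeEnergyRate` (stmt-QuantumFields-22402) of route `EntropyBudgetEquipartition`. The crux reads
`∀ G compact simple, ∀ r : LatticeRep G, ∃ K κ C β₀, 0 < κ ∧ ∀ β ≥ β₀,
 |freeEnergyDensity 4 r.ρ β + (3·finrank_ℝ(span{X | ∀ t, exp((t:ℂ)•X) ∈ range r.ρ})/2)·log β − K| ≤ C β^{−κ}`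
(with `MeasurableSpace G := borel G`). This file proves that BODY, literally, for `G = U(N)` (`N ≥ 1`) and
`r = unitaryFundamentalLatticeRep N`: the inline `finrank` is `dim_ℝ 𝔲(N) = N²` (tree
`finrank_span_eq_finrank_repLieAlgebra`, `finrank_repLieAlgebra_unitaryFundamental`), the tree's measurable structure
on `U(N)` IS `borel` (`Matrix.unitaryGroup.instMeasurableSpace := borel _`), and the rate is
`FreeEnergyRate.unitary_freeEnergyDensity_rate_four` (Chatterjee Thm 1.1 for `U(N)` with a power rate, this seat).

HONEST LABEL: `U(N)` is NOT a compact simple group (`IsCompactSimpleLieGroup U(N)` fails: positive-dimensional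
centre), so this does not instantiate or close the crux; it shows the K1 mechanism WITH RATE at the crux's literal
shape for the one family of models the tree can chart. What the crux still needs for abstract compact simple `G` is
Lie-theoretic infrastructure (exponential chart of `r(G) ⊂ U(N)` and its Haar density), not a sharper rate. Nothing
here bears on the Clay mass gap; the route serves the RECORD-label rung R2ξ-G `XiPow`.
-/

noncomputable section

namespace Summit.QuantumFields.YangMills.Theorems.FreeEnergyRate

open Literature.MathematicalPhysics.QuantumLattice
open Literature.MathematicalPhysics.QuantumFieldTheory (LatticeRep)

/-- **The body of `FreeEnergyRate` for `(U(N), unitaryFundamentalLatticeRep N)`, `N ≥ 1`** (global instances; the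
tree's measurable structure on `U(N)` is `borel` by definition): there are `K`, `κ > 0`, `C`, `β₀` with
`|freeEnergyDensity 4 r.ρ β + (3·dim_ℝ 𝔤_r/2)·log β − K| ≤ C β^{−κ}` for `β ≥ β₀`, `dim_ℝ 𝔤_r` the crux's inline
`finrank` (`= N²`). [cite: arXiv160201222, Thm. 1.1 (power rate not in print)] -/
theorem freeEnergyRate_body_unitaryGroup {N : ℕ} (hN : 1 ≤ N) :
    ∃ K κ C β₀ : ℝ, 0 < κ ∧ ∀ β : ℝ, β₀ ≤ β →
      |freeEnergyDensity 4 (unitaryFundamentalLatticeRep N).ρ β +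
          (3 * (Module.finrank ℝ ↥(Submodule.span ℝ
            {X : Matrix (Fin (unitaryFundamentalLatticeRep N).N) (Fin (unitaryFundamentalLatticeRep N).N) ℂ |
              ∀ t : ℝ, NormedSpace.exp ((t : ℂ) • X) ∈ Set.range (unitaryFundamentalLatticeRep N).ρ}) : ℝ) / 2) *
            Real.log β - K| ≤ C * β ^ (-κ) := by
  rw [finrank_span_eq_finrank_repLieAlgebra, finrank_repLieAlgebra_unitaryFundamental]
  push_cast
  exact unitary_freeEnergyDensity_rate_four hN

/-- The same statement written EXACTLY as the crux writes it, with the inline `letI : MeasurableSpace G := borel G`,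
`haveI : BorelSpace G := ⟨rfl⟩` binders at `G = U(N)` (definitionally the tree's instances). -/
theorem freeEnergyRate_body_unitaryGroup' {N : ℕ} (hN : 1 ≤ N) :
    letI : MeasurableSpace (Matrix.unitaryGroup (Fin N) ℂ) := borel _
    haveI : BorelSpace (Matrix.unitaryGroup (Fin N) ℂ) := ⟨rfl⟩
    ∀ r : LatticeRep (Matrix.unitaryGroup (Fin N) ℂ), r = unitaryFundamentalLatticeRep N →
      ∃ K κ C β₀ : ℝ, 0 < κ ∧ ∀ β : ℝ, β₀ ≤ β →
        |freeEnergyDensity 4 r.ρ β +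
            (3 * (Module.finrank ℝ ↥(Submodule.span ℝ {X : Matrix (Fin r.N) (Fin r.N) ℂ |
              ∀ t : ℝ, NormedSpace.exp ((t : ℂ) • X) ∈ Set.range r.ρ}) : ℝ) / 2) * Real.log β - K| ≤
          C * β ^ (-κ) := by
  intro r hr
  subst hr
  exact freeEnergyRate_body_unitaryGroup hN

end Summit.QuantumFields.YangMills.Theorems.FreeEnergyRate

end
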